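import Literature.Probability.LatticeModels.LatticeGreenFunction
import Literature.Probability.LatticeModels.SharpnessProofs
import HarnessLib

/-!
# Convergence of the torus Green function to the lattice Green function (ADS15 (3.15))

Trunk G02 (T-STATMECH), topic `Probability/LatticeModels`, namespace `Literature.StatMech`. Companion of
`LatticeGreenFunction.lean`: the second pure-analysis input of

* M. Aizenman, H. Duminil-Copin, V. Sidoravicius, *Random currents and continuity of Ising
  model's spontaneous magnetization*, Comm. Math. Phys. **334** (2015) 719–742, §3.3, arXiv v3
  eq. (3.15) (bib key `AizenmanDuminilCopinSidoraviciusCMP2015`; "ADS15"; equation numbers are those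
  of arXiv:1311.1937v3, as in `LatticeGreenFunction.lean`): "the sum (3.14) forms a Riemann
  approximation; under Condition (1.18) standard approximation arguments allow to conclude the
  pointwise convergence `lim_L G_L(x,y) = G(x,y)` (3.15)",

for the nearest-neighbour model in `d ≥ 3` and in the tree's normalisation (`torusGreen`,
`latticeGreen` = twice ADS15's `G_L`, `G`, see `LatticeGreenFunction.lean`).

## Main result

* `torusGreen_tendsto_latticeGreen` — for `d ≥ 3`, `z ∈ ℤ^d`, `ε > 0` there is `L₀` with
  `|torusGreen (z mod L) - latticeGreen z| ≤ ε` for all **even** `L ≥ L₀` (the tori on which the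
  infrared bound `Literature.Probability.LatticeModels.infraredBound` is available; along even `L` the grid `2πk/L`
  contains the origin-centred cell decomposition used below). This discharges the input (3.15) of
  the assembly of `M̃_LRO(β_c) = 0` from the infrared bound (companion file
  `LroInfraredBound.lean`).

## Proof architecture ("standard approximation arguments", made explicit)

Write `h_z(p) = cos(p·z)/ε(p)` (`greenIntegrand`), `δ = 2π/L` (`gridStep`).
1. `torusGreen (z mod L) = L^{-d} ∑_{k ≠ 0} h_z(p_k)` (`torusGreen_proj_eq`; the phases agree mod
   `2π`), and by `2π`-periodicity of `h_z` and the shift `k ↦ k + (L/2,…,L/2)` (even `L`) this is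
   `(2π)^{-d} ∑_{j ≠ j₀} δ^d h_z(c_j)` over the corners `c_j = -π + δ j` of the `L^d` cells of
   `[-π,π)^d`, omitting the cell `j₀` cornered at the origin (`sum_greenIntegrand_latticeMomentum_eq`).
2. The cells `c_j + [0,δ)^d` (`gridCell`) tile `[-π,π)^d`, which is a.e. `[-π,π]^d`, so
   `latticeGreen z = (2π)^{-d} ∑_j ∫_{cell_j} h_z` (`setIntegral_brillouin_eq_sum_gridCell`).
3. Far cells (corner outside the `η`-box around `0`, `δ ≤ η/2`) lie in the compact set
   `{p ∈ [-π,π]^d : ∃ i, |pᵢ| ≥ η/2}` where `h_z` is uniformly continuous, so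
   `∑_far |δ^d h_z(c_j) - ∫_{cell_j} h_z| ≤ (2π)^d ω(δ)` (`abs_sub_setIntegral_gridCell_le`).
4. Near cells, grid part: `|h_z(c_j)| ≤ (π²/2)/‖c_j‖² = (π²/2)/(δ²‖m_j‖²)` with the integer offset
   `m_j = j - L/2` (`cellOffset`), and the lattice sum bound
   `∑_{0 < ‖m‖_∞ ≤ R} ‖m‖_∞^{-2} ≤ 2d 3^{d-1} R^{d-2}` (`sum_box_inv_norm_sq_le`, shells `∂Λ_r`
   counted by `card_sphere_succ_le`) give `∑_{near, j ≠ j₀} δ^d |h_z(c_j)| ≤ π² d 3^{d-1} η^{d-2}`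
   uniformly in `L` (`sum_nearCells_abs_greenIntegrand_le`; this is where `d ≥ 3` enters).
5. Near cells, integral part: `∑_near ∫_{cell_j} |h_z| ≤ ∫_{0 < ‖p‖ ≤ 2η} 1_{[-π,π]^d}/ε → 0` as
   `η → 0` (`sum_nearCells_integral_abs_le`, `exists_setIntegral_punctBall_le`: absolute
   continuity of the integral of the integrable function `1/ε`, `d ≥ 3`).

## Design notes

* Everything is elementary real analysis on `ℝ^d` with Mathlib's `volume`; no Riemann/box-integral
  library is used. Cells are indexed by `j ∈ (ℤ/Lℤ)^d` through the representatives `(j i).val`.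
* Binders follow `LatticeGreenFunction.lean`: `d`, `L` implicit when a later explicit argument
  determines them.
* Auxiliary definitions (`greenIntegrand`, `gridStep`, `cellCorner`, `centerIndex`,
  `halfOpenBrillouin`, `gridCell`, `cellOffset`, `nearCells`, `punctBall`, `farRegion`) are proof
  devices, documented as such ([folklore]).

## Mathlib status

Anchors: `MeasureTheory.integral_iUnion_fintype`, `integral_biUnion_finset`,
`Measure.univ_pi_Ico_ae_eq_Icc`, `Real.volume_pi_Ico_toReal`, `norm_setIntegral_le_of_norm_le_const`,
`tendsto_setIntegral_of_antitone`, `IsCompact.uniformContinuousOn_of_continuous`,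
`Metric.uniformContinuousOn_iff_le`, `ZMod.val_add`, `ZMod.val_intCast`, `Nat.floor`.
-/

noncomputable section

namespace Literature.Probability.LatticeModels

open MeasureTheory Filter Topology Finset Real

variable {d : ℕ}

/-- The Green integrand `h_z(p) = cos (p·z) / ε(p)` of the tree's `latticeGreen`/`torusGreen`
(twice the integrand `e^{ip·z}/E(p)` of ADS15, arXiv v3 (3.14)–(3.15), in the nearest-neighbour
case; real part). [cite: AizenmanDuminilCopinSidoraviciusCMP2015, §3.3, arXiv v3 eq. (3.15)] -/
def greenIntegrand (z : Site d) (p : Fin d → ℝ) : ℝ :=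
  Real.cos (∑ i, p i * (z i : ℝ)) / dispersion p

/-- `latticeGreen` in terms of `greenIntegrand`. [folklore] -/
theorem latticeGreen_eq (z : Site d) :
    latticeGreen z = (∫ p in brillouin d, greenIntegrand z p) / ((2 * π) ^ d) := rfl

/-- `h_z` is `2π`-periodic in every coordinate (as `z ∈ ℤ^d`). [folklore] -/
theorem greenIntegrand_add_int_mul (z : Site d) (p : Fin d → ℝ) (n : Fin d → ℤ) :
    greenIntegrand z (fun i => p i + 2 * π * n i) = greenIntegrand z p := by
  unfold greenIntegrand dispersion
  congr 1
  · have h : ∑ i, (p i + 2 * π * n i) * (z i : ℝ) =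
        ∑ i, p i * (z i : ℝ) + ((∑ i, n i * z i : ℤ) : ℝ) * (2 * π) := by
      push_cast
      simp only [Finset.sum_mul, ← Finset.sum_add_distrib]
      exact Finset.sum_congr rfl fun i _ => by ring
    rw [h, Real.cos_add_int_mul_two_pi]
  · refine Finset.sum_congr rfl fun i _ => ?_
    simp only
    rw [show p i + 2 * π * n i = p i + n i * (2 * π) by ring, Real.cos_add_int_mul_two_pi]

/-- The torus Green function at `z mod L` as a grid sum of `h_z` over the nonzero lattice momenta.
(ADS15, arXiv v3 (3.14).) [cite: AizenmanDuminilCopinSidoraviciusCMP2015, §3.3, arXiv v3 eq. (3.14)] -/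
theorem torusGreen_proj_eq (L : ℕ) [NeZero L] (z : Site d) :
    torusGreen (Torus.proj L z) =
      (∑ k ∈ (univ : Finset (TorusSite d L)).erase 0,
        greenIntegrand z (latticeMomentum L k)) / ((L : ℝ) ^ d) := by
  unfold torusGreen greenIntegrand
  congr 1
  refine Finset.sum_congr rfl fun k _ => ?_
  congr 1
  -- the phases differ by an integer multiple of `2π`
  have hval : ∀ i, (((Torus.proj L z i).val : ℤ) : ℝ) = z i - (L : ℝ) * ((z i / L : ℤ) : ℝ) := by
    intro i
    have h := ZMod.val_intCast (n := L) (z i)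
    rw [Int.emod_def] at h
    have h' : (((z i : ZMod L).val : ℤ) : ℝ) = ((z i - L * (z i / L) : ℤ) : ℝ) := by rw [h]
    push_cast at h'
    exact h'
  have hphase : ∑ i, latticeMomentum L k i * (((Torus.proj L z) i).val : ℝ) =
      ∑ i, latticeMomentum L k i * (z i : ℝ) +
        ((-(∑ i, ((k i).val : ℤ) * (z i / L)) : ℤ) : ℝ) * (2 * π) := by
    have hcast : ∀ i, (((Torus.proj L z) i).val : ℝ) = (((Torus.proj L z i).val : ℤ) : ℝ) :=
      fun i => by norm_cast
    simp_rw [hcast, hval]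
    push_cast
    simp only [Finset.sum_mul, ← Finset.sum_add_distrib, neg_mul, ← Finset.sum_neg_distrib]
    refine Finset.sum_congr rfl fun i _ => ?_
    unfold latticeMomentum
    have hL : (L : ℝ) ≠ 0 := by exact_mod_cast NeZero.ne L
    field_simp
    ring
  rw [hphase, Real.cos_add_int_mul_two_pi]

/-! ### Grid cells of the Brillouin zone -/

/-- The grid step `δ = 2π/L`. [folklore] -/
def gridStep (L : ℕ) : ℝ := 2 * π / L

/-- The lower-left corner `c_j = -π + δ j` (`j ∈ {0,…,L-1}^d`, read off `(j i).val`) of the grid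
cell of `[-π,π)^d` indexed by `j ∈ (ℤ/Lℤ)^d`. [folklore] -/
def cellCorner {L : ℕ} (j : TorusSite d L) : Fin d → ℝ :=
  fun i => -π + gridStep L * ((j i).val : ℝ)

variable (d) in
/-- The index of the cell cornered at the origin, `j₀ = (L/2, …, L/2)`. [folklore] -/
def centerIndex (L : ℕ) : TorusSite d L := fun _ => ((L / 2 : ℕ) : ZMod L)

/-- `δ > 0`. [folklore] -/
theorem gridStep_pos (L : ℕ) [NeZero L] : 0 < gridStep L := by
  unfold gridStep
  have : (0 : ℝ) < L := by exact_mod_cast Nat.pos_of_ne_zero (NeZero.ne L)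
  positivity

/-- `δ L = 2π`. [folklore] -/
theorem gridStep_mul (L : ℕ) [NeZero L] : gridStep L * L = 2 * π := by
  unfold gridStep
  have : (L : ℝ) ≠ 0 := by exact_mod_cast NeZero.ne L
  field_simp

/-- `δ (L/2) = π` for even `L`. [folklore] -/
theorem gridStep_mul_half {L : ℕ} [NeZero L] (hL : Even L) : gridStep L * ((L / 2 : ℕ) : ℝ) = π := by
  have h2 : ((L / 2 : ℕ) : ℝ) * 2 = L := by exact_mod_cast Nat.div_two_mul_two_of_even hL
  have h : gridStep L * ((L / 2 : ℕ) : ℝ) * 2 = 2 * π := by rw [mul_assoc, h2, gridStep_mul]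
  linarith

variable (d) in
/-- The corner of the central cell is the origin (`L` even). [folklore] -/
theorem cellCorner_centerIndex {L : ℕ} [NeZero L] (hL : Even L) :
    cellCorner (centerIndex d L) = 0 := by
  funext i
  simp only [cellCorner, centerIndex, Pi.zero_apply]
  rw [ZMod.val_natCast, Nat.mod_eq_of_lt (Nat.div_lt_self (Nat.pos_of_ne_zero (NeZero.ne L)) one_lt_two),
    gridStep_mul_half hL]
  ring

/-- Shifting the momentum index by `j₀` turns lattice momenta into cell corners, up to periods:
`c_{k + j₀} = p_k - 2π q` with `q ∈ {0,1}^d`. [folklore] -/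
theorem cellCorner_add_centerIndex {L : ℕ} [NeZero L] (hL : Even L) (k : TorusSite d L) :
    ∃ q : Fin d → ℤ, cellCorner (k + centerIndex d L) =
      fun i => latticeMomentum L k i + 2 * π * (q i : ℝ) := by
  refine ⟨fun i => -((((k i).val + L / 2) / L : ℕ) : ℤ), funext fun i => ?_⟩
  have hLpos : 0 < L := Nat.pos_of_ne_zero (NeZero.ne L)
  have hval : ((k + centerIndex d L) i).val = ((k i).val + L / 2) % L := by
    simp only [Pi.add_apply, centerIndex]
    rw [ZMod.val_add, ZMod.val_natCast, Nat.mod_eq_of_lt (Nat.div_lt_self hLpos one_lt_two)]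
  have hmod : ((((k i).val + L / 2) % L : ℕ) : ℝ) =
      ((k i).val : ℝ) + ((L / 2 : ℕ) : ℝ) - (L : ℝ) * ((((k i).val + L / 2) / L : ℕ) : ℝ) := by
    have h := Nat.mod_add_div ((k i).val + L / 2) L
    have h' : ((((k i).val + L / 2) % L : ℕ) : ℝ) + (L : ℝ) * ((((k i).val + L / 2) / L : ℕ) : ℝ) =
        ((k i).val : ℝ) + ((L / 2 : ℕ) : ℝ) := by exact_mod_cast h
    linarith
  simp only [cellCorner]
  rw [hval, hmod]
  unfold latticeMomentum
  simp only [Int.cast_neg, Int.cast_natCast]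
  have hπ := gridStep_mul_half (L := L) hL
  have hδL := gridStep_mul L
  have hg : 2 * π * ((k i).val : ℝ) / L = gridStep L * ((k i).val : ℝ) := by
    unfold gridStep; ring
  rw [hg]
  linear_combination hπ - ((((k i).val + L / 2) / L : ℕ) : ℝ) * hδL

/-- **Reindexing the grid sum**: for even `L`, the sum of `h_z` over the nonzero lattice momenta
equals the sum of `h_z` over the corners of all cells of `[-π,π)^d` except the central one
(periodicity of `h_z`). [folklore] -/
theorem sum_greenIntegrand_latticeMomentum_eq {L : ℕ} [NeZero L] (hL : Even L) (z : Site d) :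
    ∑ k ∈ (univ : Finset (TorusSite d L)).erase 0, greenIntegrand z (latticeMomentum L k) =
      ∑ j ∈ (univ : Finset (TorusSite d L)).erase (centerIndex d L),
        greenIntegrand z (cellCorner j) := by
  have hterm : ∀ k : TorusSite d L, greenIntegrand z (latticeMomentum L k) =
      greenIntegrand z (cellCorner (k + centerIndex d L)) := fun k => by
    obtain ⟨q, hq⟩ := cellCorner_add_centerIndex hL k
    rw [hq, greenIntegrand_add_int_mul]
  rw [Finset.sum_erase_eq_sub (mem_univ _), Finset.sum_erase_eq_sub (mem_univ _)]
  simp_rw [hterm]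
  rw [zero_add]
  congr 1
  exact Equiv.sum_comp (Equiv.addRight (centerIndex d L)) fun j => greenIntegrand z (cellCorner j)


variable (d) in
/-- The half-open Brillouin zone `[-π, π)^d`. [folklore] -/
def halfOpenBrillouin : Set (Fin d → ℝ) :=
  Set.pi Set.univ fun _ => Set.Ico (-π) π

/-- The grid cell `c_j + [0, δ)^d` of `[-π,π)^d` indexed by `j ∈ (ℤ/Lℤ)^d`. [folklore] -/
def gridCell {L : ℕ} (j : TorusSite d L) : Set (Fin d → ℝ) :=
  Set.pi Set.univ fun i => Set.Ico (cellCorner j i) (cellCorner j i + gridStep L)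

/-- Cells are measurable. [folklore] -/
theorem measurableSet_gridCell {L : ℕ} (j : TorusSite d L) : MeasurableSet (gridCell j) :=
  MeasurableSet.univ_pi fun _ => measurableSet_Ico

variable (d) in
/-- `[-π,π)^d ⊆ [-π,π]^d`. [folklore] -/
theorem halfOpenBrillouin_subset_brillouin : halfOpenBrillouin d ⊆ brillouin d :=
  Set.pi_mono fun _ _ => Set.Ico_subset_Icc_self

variable (d) in
/-- `[-π,π]^d` and `[-π,π)^d` agree up to a Lebesgue-null set. [folklore] -/
theorem halfOpenBrillouin_ae_eq_brillouin :
    halfOpenBrillouin d =ᵐ[volume] brillouin d := by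
  have h := (Measure.univ_pi_Ico_ae_eq_Icc (μ := fun _ : Fin d => (volume : Measure ℝ))
    (f := fun _ => -π) (g := fun _ => π))
  rw [← Set.pi_univ_Icc] at h
  exact h

/-- The cell edges lie in `[-π, π]`: `-π ≤ c_j i` and `c_j i + δ ≤ π`. [folklore] -/
theorem cellCorner_le_iff {L : ℕ} [NeZero L] (j : TorusSite d L) (i : Fin d) :
    -π ≤ cellCorner j i ∧ cellCorner j i + gridStep L ≤ π := by
  have hδ := gridStep_pos L
  have hδL := gridStep_mul L
  have hval : ((j i).val : ℝ) + 1 ≤ L := by exact_mod_cast ZMod.val_lt (j i)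
  have h0 : (0 : ℝ) ≤ (j i).val := Nat.cast_nonneg _
  constructor
  · simp only [cellCorner]
    nlinarith
  · simp only [cellCorner]
    nlinarith

/-- Cells lie in `[-π,π)^d`. [folklore] -/
theorem gridCell_subset_halfOpenBrillouin {L : ℕ} [NeZero L] (j : TorusSite d L) :
    gridCell j ⊆ halfOpenBrillouin d := by
  refine Set.pi_mono fun i _ => ?_
  obtain ⟨h1, h2⟩ := cellCorner_le_iff j i
  exact Set.Ico_subset_Ico h1 h2

variable (d) in
/-- Distinct cells are disjoint. [folklore] -/
theorem pairwise_disjoint_gridCell (L : ℕ) [NeZero L] :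
    Pairwise (Function.onFun Disjoint (gridCell (d := d) (L := L))) := by
  intro j j' hjj'
  obtain ⟨i, hi⟩ : ∃ i, j i ≠ j' i := Function.ne_iff.1 hjj'
  have hne : (j i).val ≠ (j' i).val := fun h => hi (ZMod.val_injective L h)
  have hδ := gridStep_pos L
  refine Set.disjoint_univ_pi.2 ⟨i, ?_⟩
  rw [Set.Ico_disjoint_Ico]
  simp only [cellCorner]
  rcases lt_or_gt_of_ne hne with h | h
  · have h' : ((j i).val : ℝ) + 1 ≤ (j' i).val := by exact_mod_cast h
    rw [min_eq_left (by nlinarith), max_eq_right (by nlinarith)]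
    nlinarith
  · have h' : ((j' i).val : ℝ) + 1 ≤ (j i).val := by exact_mod_cast h
    rw [min_eq_right (by nlinarith), max_eq_left (by nlinarith)]
    nlinarith

variable (d) in
/-- The cells tile the half-open Brillouin zone. [folklore] -/
theorem iUnion_gridCell (L : ℕ) [NeZero L] :
    ⋃ j : TorusSite d L, gridCell j = halfOpenBrillouin d := by
  refine Set.Subset.antisymm (Set.iUnion_subset fun j => gridCell_subset_halfOpenBrillouin j) ?_
  intro p hp
  have hδ := gridStep_pos L
  have hδL := gridStep_mul L
  have hLpos : 0 < L := Nat.pos_of_ne_zero (NeZero.ne L)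
  -- the index of the cell containing `p`
  set n : Fin d → ℕ := fun i => ⌊(p i + π) / gridStep L⌋₊ with hn
  have hp' : ∀ i, -π ≤ p i ∧ p i < π := fun i => (hp i (Set.mem_univ i))
  have hnlt : ∀ i, n i < L := fun i => by
    have h1 : (p i + π) / gridStep L < L := by
      rw [div_lt_iff₀ hδ]
      nlinarith [(hp' i).2]
    exact (Nat.floor_lt (div_nonneg (by linarith [(hp' i).1]) hδ.le)).2 h1
  refine Set.mem_iUnion.2 ⟨fun i => (n i : ZMod L), fun i _ => ?_⟩
  have hval : (((n i : ℕ) : ZMod L).val : ℝ) = n i := by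
    rw [ZMod.val_natCast, Nat.mod_eq_of_lt (hnlt i)]
  simp only [cellCorner, hval]
  have ht : 0 ≤ (p i + π) / gridStep L := div_nonneg (by linarith [(hp' i).1]) hδ.le
  have hfl := Nat.floor_le ht
  have hlt := Nat.lt_floor_add_one ((p i + π) / gridStep L)
  constructor
  · -- `-π + δ n ≤ p`
    have : gridStep L * (n i : ℝ) ≤ p i + π := by
      calc gridStep L * (n i : ℝ) ≤ gridStep L * ((p i + π) / gridStep L) := by gcongr
        _ = p i + π := by field_simp
    linarith
  · have : p i + π < gridStep L * ((n i : ℝ) + 1) := by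
      calc p i + π = gridStep L * ((p i + π) / gridStep L) := by field_simp
        _ < gridStep L * ((n i : ℝ) + 1) := by gcongr
    linarith

/-- The volume of a cell is `δ^d`. [folklore] -/
theorem volume_gridCell_toReal {L : ℕ} [NeZero L] (j : TorusSite d L) :
    (volume (gridCell j)).toReal = gridStep L ^ d := by
  unfold gridCell
  rw [Real.volume_pi_Ico_toReal (fun i => by linarith [gridStep_pos L])]
  simp

/-- Cells have finite volume. [folklore] -/
theorem volume_gridCell_lt_top {L : ℕ} (j : TorusSite d L) : volume (gridCell j) < ⊤ := by
  unfold gridCell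
  rw [Real.volume_pi_Ico]
  exact ENNReal.prod_lt_top fun _ _ => ENNReal.ofReal_lt_top

/-- **Tiling of the Brillouin integral**: `∫_{[-π,π]^d} g = ∑_j ∫_{cell_j} g` for `g` integrable on
`[-π,π]^d`. [folklore] -/
theorem setIntegral_brillouin_eq_sum_gridCell (L : ℕ) [NeZero L] {g : (Fin d → ℝ) → ℝ}
    (hg : IntegrableOn g (brillouin d) volume) :
    ∫ p in brillouin d, g p = ∑ j : TorusSite d L, ∫ p in gridCell j, g p := by
  rw [← setIntegral_congr_set (halfOpenBrillouin_ae_eq_brillouin d), ← iUnion_gridCell d L,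
    integral_iUnion_fintype (fun j => measurableSet_gridCell j) (pairwise_disjoint_gridCell d L)]
  exact fun j => hg.mono_set
    ((gridCell_subset_halfOpenBrillouin j).trans (halfOpenBrillouin_subset_brillouin d))


/-! ### A lattice sum near the singularity -/

variable (d) in
/-- `Λ_0 = {0}`. [folklore] -/
theorem box_zero_eq : box d 0 = {0} := by
  ext x
  simp only [mem_box, Nat.cast_zero, neg_zero, Finset.mem_singleton]
  constructor
  · intro h; funext i; have := h i; simp only [Pi.zero_apply]; omega
  · rintro rfl i; simp

variable (d) in
/-- **Lattice sum bound**: `∑_{0 < ‖m‖_∞ ≤ R} ‖m‖_∞^{-2} ≤ 2d·3^{d-1} R^{d-2}` for `d ≥ 3`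
(shell decomposition, `|∂Λ_r| ≤ 2d(2r+1)^{d-1}`). [folklore] -/
theorem sum_box_inv_norm_sq_le (hd : 3 ≤ d) (R : ℕ) :
    ∑ m ∈ (box d R).erase 0, (‖m‖ ^ 2)⁻¹ ≤ 2 * d * 3 ^ (d - 1) * (R : ℝ) ^ (d - 2) := by
  obtain ⟨e, rfl⟩ : ∃ e, d = e + 3 := ⟨d - 3, by omega⟩
  rw [show e + 3 - 1 = e + 2 by omega, show e + 3 - 2 = e + 1 by omega]
  induction R with
  | zero => simp [box_zero_eq]
  | succ R ih =>
    -- split off the shell `∂Λ_{R+1}`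
    have hsplit : (box (e + 3) (R + 1)).erase 0 = (box (e + 3) R).erase 0 ∪ sphere (e + 3) (R + 1) := by
      rw [sphere_succ_eq_sdiff]
      ext m
      simp only [Finset.mem_erase, Finset.mem_union, Finset.mem_sdiff]
      have h0 : (0 : Site (e + 3)) ∈ box (e + 3) R := zero_mem_box _ _
      have hsub : m ∈ box (e + 3) R → m ∈ box (e + 3) (R + 1) := fun h => box_mono _ (Nat.le_succ R) h
      by_cases hm : m ∈ box (e + 3) R
      · simp [hm, hsub hm]
      · simp only [hm, not_false_eq_true, and_true, and_false, false_or]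
        constructor
        · exact fun h => h.2
        · intro h; exact ⟨fun h' => hm (h' ▸ h0), h⟩
    have hdisj : Disjoint ((box (e + 3) R).erase 0) (sphere (e + 3) (R + 1)) := by
      rw [sphere_succ_eq_sdiff, Finset.disjoint_left]
      intro m hm hm'
      exact (Finset.mem_sdiff.1 hm').2 (Finset.mem_of_mem_erase hm)
    rw [hsplit, Finset.sum_union hdisj]
    -- on the shell, `‖m‖ = R + 1`
    have hshell : ∑ m ∈ sphere (e + 3) (R + 1), (‖m‖ ^ 2)⁻¹ =
        (#(sphere (e + 3) (R + 1)) : ℝ) * (((R : ℝ) + 1) ^ 2)⁻¹ := by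
      rw [Finset.sum_congr rfl fun m hm => by rw [Site.norm_eq_supNorm, mem_sphere.1 hm],
        sum_const, nsmul_eq_mul]
      push_cast
      ring
    rw [hshell]
    have hcard := card_sphere_succ_le (d := e + 3) R
    rw [show e + 3 - 1 = e + 2 by omega] at hcard
    push_cast at hcard ih ⊢
    have hR : (0 : ℝ) ≤ R := Nat.cast_nonneg R
    -- `(2R+3)^{e+2} ≤ 3^{e+2} (R+1)^{e+2}`
    have h3 : (2 * (R : ℝ) + 3) ^ (e + 2) ≤ (3 : ℝ) ^ (e + 2) * ((R : ℝ) + 1) ^ (e + 2) := by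
      rw [← mul_pow]; gcongr; linarith
    -- `R^{e+1} + (R+1)^e ≤ (R+1)^{e+1}`
    have h4 : (R : ℝ) ^ (e + 1) + ((R : ℝ) + 1) ^ e ≤ ((R : ℝ) + 1) ^ (e + 1) := by
      have h : (R : ℝ) ^ (e + 1) ≤ R * ((R : ℝ) + 1) ^ e := by
        rw [pow_succ']; gcongr; linarith
      have h' : ((R : ℝ) + 1) ^ (e + 1) = R * ((R : ℝ) + 1) ^ e + ((R : ℝ) + 1) ^ e := by ring
      rw [h']
      linarith
    have hpos : (0 : ℝ) < ((R : ℝ) + 1) ^ 2 := by positivity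
    calc ∑ m ∈ (box (e + 3) R).erase 0, (‖m‖ ^ 2)⁻¹ +
          (#(sphere (e + 3) (R + 1)) : ℝ) * (((R : ℝ) + 1) ^ 2)⁻¹
        ≤ 2 * ((e : ℝ) + 3) * 3 ^ (e + 2) * (R : ℝ) ^ (e + 1) +
          2 * ((e : ℝ) + 3) * (2 * (R : ℝ) + 3) ^ (e + 2) * (((R : ℝ) + 1) ^ 2)⁻¹ := by
          gcongr
      _ ≤ 2 * ((e : ℝ) + 3) * 3 ^ (e + 2) * (R : ℝ) ^ (e + 1) +
          2 * ((e : ℝ) + 3) * ((3 : ℝ) ^ (e + 2) * ((R : ℝ) + 1) ^ (e + 2)) * (((R : ℝ) + 1) ^ 2)⁻¹ := by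
          gcongr
      _ = 2 * ((e : ℝ) + 3) * 3 ^ (e + 2) * ((R : ℝ) ^ (e + 1) + ((R : ℝ) + 1) ^ e) := by
          field_simp
          ring
      _ ≤ 2 * ((e : ℝ) + 3) * 3 ^ (e + 2) * ((R : ℝ) + 1) ^ (e + 1) := by
          gcongr


/-! ### Cells near the singularity: the grid-sum part -/

/-- The integer offset `m_j = j - L/2 ∈ [-L/2, L/2)^d` of a cell index, so that `c_j = δ m_j` for
even `L`. [folklore] -/
def cellOffset {L : ℕ} (j : TorusSite d L) : Site d :=
  fun i => ((j i).val : ℤ) - ((L / 2 : ℕ) : ℤ)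

/-- `c_j = δ m_j` for even `L`. [folklore] -/
theorem cellCorner_eq_gridStep_mul {L : ℕ} [NeZero L] (hL : Even L) (j : TorusSite d L) (i : Fin d) :
    cellCorner j i = gridStep L * (cellOffset j i : ℝ) := by
  simp only [cellCorner, cellOffset, Int.cast_sub, Int.cast_natCast, mul_sub, gridStep_mul_half hL]
  ring

variable (d) in
/-- `j ↦ m_j` is injective. [folklore] -/
theorem cellOffset_injective (L : ℕ) [NeZero L] :
    Function.Injective (cellOffset (d := d) (L := L)) := by
  intro j j' h
  funext i
  have hi := congr_fun h i
  simp only [cellOffset, sub_left_inj, Nat.cast_inj] at hi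
  exact ZMod.val_injective L hi

/-- `m_j = 0` exactly for the central cell. [folklore] -/
theorem cellOffset_eq_zero_iff {L : ℕ} [NeZero L] (j : TorusSite d L) :
    cellOffset j = 0 ↔ j = centerIndex d L := by
  have hLpos : 0 < L := Nat.pos_of_ne_zero (NeZero.ne L)
  have hc : cellOffset (centerIndex d L) = 0 := by
    funext i
    simp only [cellOffset, centerIndex, Pi.zero_apply, ZMod.val_natCast,
      Nat.mod_eq_of_lt (Nat.div_lt_self hLpos one_lt_two), sub_self]
  constructor
  · intro h
    exact cellOffset_injective d L (h.trans hc.symm)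
  · rintro rfl; exact hc

/-- `‖c_j‖_∞ = δ ‖m_j‖_∞` for even `L`. [folklore] -/
theorem norm_cellCorner {L : ℕ} [NeZero L] (hL : Even L) (j : TorusSite d L) :
    ‖cellCorner j‖ = gridStep L * ‖cellOffset j‖ := by
  have h : cellCorner j = gridStep L • fun i => (cellOffset j i : ℝ) := by
    funext i; simp [cellCorner_eq_gridStep_mul hL]
  rw [h, norm_smul, Real.norm_of_nonneg (gridStep_pos L).le]
  simp only [Pi.norm_def]
  rfl

/-- Corners lie in the Brillouin zone. [folklore] -/
theorem cellCorner_mem_brillouin {L : ℕ} [NeZero L] (j : TorusSite d L) :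
    cellCorner j ∈ brillouin d := fun i _ => by
  obtain ⟨h1, h2⟩ := cellCorner_le_iff j i
  exact ⟨h1, by linarith [gridStep_pos L]⟩

/-- `|h_z(p)| ≤ (π²/2) ‖p‖^{-2}` on the Brillouin zone. [folklore] -/
theorem abs_greenIntegrand_le {z : Site d} {p : Fin d → ℝ} (hp : p ∈ brillouin d) (hp0 : p ≠ 0) :
    |greenIntegrand z p| ≤ π ^ 2 / 2 * (‖p‖ ^ 2)⁻¹ := by
  have hε := mul_norm_sq_le_dispersion hp
  have hεpos := dispersion_pos_of_mem_brillouin hp hp0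
  have hpos : 0 < ‖p‖ := norm_pos_iff.2 hp0
  rw [greenIntegrand, abs_div, abs_of_pos hεpos]
  calc |Real.cos (∑ i, p i * (z i : ℝ))| / dispersion p ≤ 1 / dispersion p := by
        gcongr; exact Real.abs_cos_le_one _
    _ ≤ 1 / (2 / π ^ 2 * ‖p‖ ^ 2) := one_div_le_one_div_of_le (by positivity) hε
    _ = π ^ 2 / 2 * (‖p‖ ^ 2)⁻¹ := by
        have hπ : (π : ℝ) ≠ 0 := Real.pi_ne_zero
        field_simp

variable (d) in
/-- The near cells: all coordinates of the corner within `η` of `0`. [folklore] -/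
def nearCells (L : ℕ) [NeZero L] (η : ℝ) : Finset (TorusSite d L) :=
  (univ : Finset (TorusSite d L)).filter fun j => ∀ i, |cellCorner j i| ≤ η

variable (d) in
/-- **Grid sum over the near cells**: for even `L` and `d ≥ 3`,
`∑_{j near, j ≠ j₀} δ^d |h_z(c_j)| ≤ π² d 3^{d-1} η^{d-2}`, uniformly in `L`
(`|h_z(c_j)| ≤ (π²/2)/(δ²‖m_j‖²)` and the lattice sum bound). [folklore] -/
theorem sum_nearCells_abs_greenIntegrand_le (hd : 3 ≤ d) {L : ℕ} [NeZero L] (hL : Even L)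
    (z : Site d) {η : ℝ} (hη : 0 < η) :
    ∑ j ∈ (nearCells d L η).erase (centerIndex d L),
        gridStep L ^ d * |greenIntegrand z (cellCorner j)| ≤
      π ^ 2 * d * 3 ^ (d - 1) * η ^ (d - 2) := by
  have hδ := gridStep_pos L
  set R : ℕ := ⌊η / gridStep L⌋₊ with hR
  set S := (nearCells d L η).erase (centerIndex d L) with hS
  -- termwise bound
  have hterm : ∀ j ∈ S, gridStep L ^ d * |greenIntegrand z (cellCorner j)| ≤
      π ^ 2 / 2 * gridStep L ^ (d - 2) * (‖cellOffset j‖ ^ 2)⁻¹ := by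
    intro j hj
    have hj0 : j ≠ centerIndex d L := (Finset.mem_erase.1 hj).1
    have hm0 : cellOffset j ≠ 0 := fun h => hj0 ((cellOffset_eq_zero_iff j).1 h)
    have hc0 : cellCorner j ≠ 0 := by
      intro h
      have := norm_cellCorner hL j
      rw [h, norm_zero] at this
      have hpos : 0 < ‖cellOffset j‖ := norm_pos_iff.2 hm0
      nlinarith
    have hb := abs_greenIntegrand_le (z := z) (cellCorner_mem_brillouin j) hc0
    rw [norm_cellCorner hL j] at hb
    obtain ⟨e, rfl⟩ : ∃ e, d = e + 2 := ⟨d - 2, by omega⟩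
    rw [show e + 2 - 2 = e by omega]
    calc gridStep L ^ (e + 2) * |greenIntegrand z (cellCorner j)|
        ≤ gridStep L ^ (e + 2) * (π ^ 2 / 2 * ((gridStep L * ‖cellOffset j‖) ^ 2)⁻¹) := by
          gcongr
      _ = π ^ 2 / 2 * gridStep L ^ e * (‖cellOffset j‖ ^ 2)⁻¹ := by
          field_simp
          ring
  -- the offsets of near cells lie in `Λ_R ∖ {0}`
  have himage : S.image cellOffset ⊆ (box d R).erase 0 := by
    intro m hm
    obtain ⟨j, hj, rfl⟩ := Finset.mem_image.1 hm
    have hj0 : j ≠ centerIndex d L := (Finset.mem_erase.1 hj).1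
    have hjn : ∀ i, |cellCorner j i| ≤ η := (Finset.mem_filter.1 (Finset.mem_erase.1 hj).2).2
    refine Finset.mem_erase.2 ⟨fun h => hj0 ((cellOffset_eq_zero_iff j).1 h), ?_⟩
    rw [mem_box_iff_supNorm_le, Site.supNorm_le_iff]
    intro i
    have h1 : |(cellOffset j i : ℝ)| ≤ η / gridStep L := by
      rw [le_div_iff₀ hδ, mul_comm, ← abs_of_pos hδ, ← abs_mul, ← cellCorner_eq_gridStep_mul hL]
      exact hjn i
    have h2 : (((cellOffset j i).natAbs : ℕ) : ℝ) ≤ η / gridStep L := by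
      rw [Nat.cast_natAbs, Int.cast_abs]; exact h1
    exact (Nat.le_floor_iff (div_nonneg hη.le hδ.le)).2 h2
  -- compare with the lattice sum
  have hsum : ∑ j ∈ S, (‖cellOffset j‖ ^ 2)⁻¹ ≤ ∑ m ∈ (box d R).erase 0, (‖m‖ ^ 2)⁻¹ := by
    rw [← Finset.sum_image (f := fun m : Site d => (‖m‖ ^ 2)⁻¹)
      (fun j _ j' _ h => cellOffset_injective d L h)]
    exact Finset.sum_le_sum_of_subset_of_nonneg himage fun _ _ _ => by positivity
  have hlat := sum_box_inv_norm_sq_le d hd R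
  have hRη : gridStep L * R ≤ η := by
    rw [mul_comm, ← le_div_iff₀ hδ]
    exact Nat.floor_le (div_nonneg hη.le hδ.le)
  obtain ⟨e, rfl⟩ : ∃ e, d = e + 3 := ⟨d - 3, by omega⟩
  rw [show e + 3 - 1 = e + 2 by omega, show e + 3 - 2 = e + 1 by omega] at hlat ⊢
  rw [show e + 3 - 2 = e + 1 by omega] at hterm
  calc ∑ j ∈ S, gridStep L ^ (e + 3) * |greenIntegrand z (cellCorner j)|
      ≤ ∑ j ∈ S, π ^ 2 / 2 * gridStep L ^ (e + 1) * (‖cellOffset j‖ ^ 2)⁻¹ :=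
        Finset.sum_le_sum hterm
    _ = π ^ 2 / 2 * gridStep L ^ (e + 1) * ∑ j ∈ S, (‖cellOffset j‖ ^ 2)⁻¹ := by
        rw [Finset.mul_sum]
    _ ≤ π ^ 2 / 2 * gridStep L ^ (e + 1) * (2 * ((e + 3 : ℕ) : ℝ) * 3 ^ (e + 2) * (R : ℝ) ^ (e + 1)) := by
        gcongr
        exact hsum.trans hlat
    _ = π ^ 2 * ((e + 3 : ℕ) : ℝ) * 3 ^ (e + 2) * (gridStep L * R) ^ (e + 1) := by ring
    _ ≤ π ^ 2 * ((e + 3 : ℕ) : ℝ) * 3 ^ (e + 2) * η ^ (e + 1) := by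
        gcongr


/-! ### Cells near the singularity: the integral part -/

/-- Cells lie in `[-π,π]^d`. [folklore] -/
theorem gridCell_subset_brillouin {L : ℕ} [NeZero L] (j : TorusSite d L) :
    gridCell j ⊆ brillouin d :=
  (gridCell_subset_halfOpenBrillouin j).trans (halfOpenBrillouin_subset_brillouin d)

/-- `h_z` is measurable. [folklore] -/
theorem measurable_greenIntegrand (z : Site d) : Measurable (greenIntegrand z) := by
  unfold greenIntegrand
  refine Measurable.div ?_ (continuous_dispersion d).measurable
  fun_prop

/-- On the Brillouin zone `|h_z| ≤ 1/ε` (with the junk `1/0 = 0` at the origin matched by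
`h_z(0) = 0`). [folklore] -/
theorem abs_greenIntegrand_le_indicator (z : Site d) {p : Fin d → ℝ} (hp : p ∈ brillouin d) :
    |greenIntegrand z p| ≤ (brillouin d).indicator (fun p => 1 / dispersion p) p := by
  rw [Set.indicator_of_mem hp]
  rcases eq_or_ne p 0 with rfl | hp0
  · simp [greenIntegrand, dispersion]
  · have hε := dispersion_pos_of_mem_brillouin hp hp0
    rw [greenIntegrand, abs_div, abs_of_pos hε]
    gcongr
    exact Real.abs_cos_le_one _

variable (d) in
/-- `h_z` is integrable on the Brillouin zone for `d ≥ 3`. [folklore] -/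
theorem integrableOn_greenIntegrand (hd : 3 ≤ d) (z : Site d) :
    IntegrableOn (greenIntegrand z) (brillouin d) := by
  refine Integrable.mono' ((integrable_indicator_inv_dispersion d hd).integrableOn)
    (measurable_greenIntegrand z).aestronglyMeasurable ?_
  refine ae_restrict_of_forall_mem (measurableSet_brillouin d) fun p hp => ?_
  rw [Real.norm_eq_abs]
  exact abs_greenIntegrand_le_indicator z hp

variable (d) in
/-- The punctured sup-norm ball `{0 < ‖p‖ ≤ t}`. [folklore] -/
def punctBall (t : ℝ) : Set (Fin d → ℝ) := {p | 0 < ‖p‖ ∧ ‖p‖ ≤ t}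

variable (d) in
/-- Punctured balls are measurable. [folklore] -/
theorem measurableSet_punctBall (t : ℝ) : MeasurableSet (punctBall d t) :=
  (measurableSet_lt measurable_const continuous_norm.measurable).inter
    (measurableSet_le continuous_norm.measurable measurable_const)

variable (d) in
/-- **Integrals over the near cells** are dominated by the integral of `1/ε` over a small punctured
ball: if `δ ≤ η`, `∑_{j near} ∫_{cell_j} |h_z| ≤ ∫_{0 < ‖p‖ ≤ 2η} 1_{[-π,π]^d}/ε`. [folklore] -/
theorem sum_nearCells_integral_abs_le (hd : 3 ≤ d) {L : ℕ} [NeZero L] (z : Site d) {η : ℝ}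
    (hδη : gridStep L ≤ η) :
    ∑ j ∈ nearCells d L η, ∫ p in gridCell j, |greenIntegrand z p| ≤
      ∫ p in punctBall d (2 * η), (brillouin d).indicator (fun p => 1 / dispersion p) p := by
  set f := (brillouin d).indicator (fun p : Fin d → ℝ => 1 / dispersion p) with hf
  set U := ⋃ j ∈ nearCells d L η, gridCell j with hU'
  have hU : MeasurableSet U :=
    Finset.measurableSet_biUnion _ fun j _ => measurableSet_gridCell j
  have hUB : U ⊆ brillouin d := Set.iUnion₂_subset fun j _ => gridCell_subset_brillouin j
  have hint : IntegrableOn (fun p => |greenIntegrand z p|) (brillouin d) :=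
    (integrableOn_greenIntegrand d hd z).abs
  have h1 : ∑ j ∈ nearCells d L η, ∫ p in gridCell j, |greenIntegrand z p| =
      ∫ p in U, |greenIntegrand z p| := by
    rw [integral_biUnion_finset (nearCells d L η) (fun j _ => measurableSet_gridCell j)
      ((pairwise_disjoint_gridCell d L).set_pairwise _)
      (fun j _ => hint.mono_set (gridCell_subset_brillouin j))]
  rw [h1, ← integral_indicator hU, ← integral_indicator (measurableSet_punctBall d _)]
  have hf0 : ∀ q, 0 ≤ f q := fun q => Set.indicator_nonneg
    (fun q _ => div_nonneg zero_le_one (dispersion_nonneg q)) q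
  refine integral_mono ((hint.mono_set hUB).integrable_indicator hU)
    ((integrable_indicator_inv_dispersion d hd).indicator (measurableSet_punctBall d _)) fun p => ?_
  by_cases hpU : p ∈ U
  · rw [Set.indicator_of_mem hpU]
    obtain ⟨j, hj, hpj⟩ := Set.mem_iUnion₂.1 hpU
    have hjn : ∀ i, |cellCorner j i| ≤ η := (Finset.mem_filter.1 hj).2
    have hpB : p ∈ brillouin d := gridCell_subset_brillouin j hpj
    rcases eq_or_ne p 0 with rfl | hp0
    · simp only [greenIntegrand, dispersion, Pi.zero_apply, zero_mul, Finset.sum_const_zero,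
        Real.cos_zero, sub_self, div_zero, abs_zero]
      exact Set.indicator_nonneg (fun q _ => hf0 q) _
    · have hη : 0 ≤ η := le_trans (abs_nonneg _) (hjn ⟨0, by omega⟩)
      have hpA : p ∈ punctBall d (2 * η) := by
        refine ⟨norm_pos_iff.2 hp0, (pi_norm_le_iff_of_nonneg (by linarith)).2 fun i => ?_⟩
        have h := hpj i (Set.mem_univ i)
        rw [Real.norm_eq_abs, abs_le]
        have := hjn i
        rw [abs_le] at this
        constructor <;> linarith [h.1, h.2]
      rw [Set.indicator_of_mem hpA]
      exact abs_greenIntegrand_le_indicator z hpB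
  · rw [Set.indicator_of_notMem hpU]
    exact Set.indicator_nonneg (fun q _ => hf0 q) _

variable (d) in
/-- The integral of `1/ε` over the punctured ball `{0 < ‖p‖ ≤ t}` is small for small `t`
(absolute continuity of the integral; the punctured balls decrease to `∅`). [folklore] -/
theorem exists_setIntegral_punctBall_le (hd : 3 ≤ d) {ε : ℝ} (hε : 0 < ε) :
    ∃ t > 0, ∀ t' > 0, t' ≤ t →
      ∫ p in punctBall d t', (brillouin d).indicator (fun p => 1 / dispersion p) p ≤ ε := by
  set f := (brillouin d).indicator (fun p : Fin d → ℝ => 1 / dispersion p) with hf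
  have hf0 : ∀ q, 0 ≤ f q := fun q => Set.indicator_nonneg
    (fun q _ => div_nonneg zero_le_one (dispersion_nonneg q)) q
  have hfi := integrable_indicator_inv_dispersion d hd
  have hanti : Antitone (fun n : ℕ => punctBall d (1 / ((n : ℝ) + 1))) := by
    intro m n hmn p hp
    refine ⟨hp.1, hp.2.trans ?_⟩
    gcongr
  have hlim := tendsto_setIntegral_of_antitone (μ := volume) (f := f)
    (fun n => measurableSet_punctBall d _) hanti ⟨0, hfi.integrableOn⟩
  have hempty : (⋂ n : ℕ, punctBall d (1 / ((n : ℝ) + 1))) = ∅ := by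
    ext p
    simp only [Set.mem_iInter, Set.mem_empty_iff_false, iff_false]
    intro h
    obtain ⟨n, hn⟩ := exists_nat_one_div_lt (h 0).1
    exact absurd hn (not_lt.2 (h n).2)
  rw [hempty, Measure.restrict_empty, integral_zero_measure] at hlim
  obtain ⟨n, hn⟩ := (hlim.eventually (Iic_mem_nhds hε)).exists
  refine ⟨1 / ((n : ℝ) + 1), by positivity, fun t' ht' ht'le => le_trans ?_ hn⟩
  refine setIntegral_mono_set hfi.integrableOn (Eventually.of_forall hf0)
    (Eventually.of_forall fun p hp => ?_)
  exact ⟨hp.1, hp.2.trans ht'le⟩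


/-! ### Cells away from the singularity -/

variable (d) in
/-- The part of the Brillouin zone where some coordinate is at least `η` in absolute value; `h_z`
is continuous there. [folklore] -/
def farRegion (η : ℝ) : Set (Fin d → ℝ) := brillouin d ∩ {p | ∃ i, η ≤ |p i|}

variable (d) in
/-- The far region is compact. [folklore] -/
theorem isCompact_farRegion (η : ℝ) : IsCompact (farRegion d η) := by
  refine (isCompact_brillouin d).inter_right ?_
  have h : {p : Fin d → ℝ | ∃ i, η ≤ |p i|} = ⋃ i, {p | η ≤ |p i|} := by
    ext p; simp
  rw [h]
  exact isClosed_iUnion_of_finite fun i =>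
    isClosed_le continuous_const (continuous_abs.comp (continuous_apply i))

/-- `h_z` is continuous on the far region (`ε ≠ 0` there), `η > 0`. [folklore] -/
theorem continuousOn_greenIntegrand (z : Site d) {η : ℝ} (hη : 0 < η) :
    ContinuousOn (greenIntegrand z) (farRegion d η) := by
  have hnum : Continuous fun p : Fin d → ℝ => Real.cos (∑ i, p i * (z i : ℝ)) := by fun_prop
  refine hnum.continuousOn.div (continuous_dispersion d).continuousOn fun p hp => ?_
  obtain ⟨hpB, i, hi⟩ := hp
  have hp0 : p ≠ 0 := by
    rintro rfl
    simp only [Pi.zero_apply, abs_zero] at hi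
    linarith
  exact (dispersion_pos_of_mem_brillouin hpB hp0).ne'

/-- A far cell (some coordinate of its corner beyond `η`) lies in `farRegion (η/2)` once
`δ ≤ η/2`. [folklore] -/
theorem gridCell_subset_farRegion {L : ℕ} [NeZero L] {η : ℝ} (hδ : gridStep L ≤ η / 2)
    {j : TorusSite d L} (hj : j ∉ nearCells d L η) :
    gridCell j ⊆ farRegion d (η / 2) := by
  intro p hp
  refine ⟨gridCell_subset_brillouin j hp, ?_⟩
  simp only [nearCells, Finset.mem_filter, Finset.mem_univ, true_and, not_forall, not_le] at hj
  obtain ⟨i, hi⟩ := hj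
  refine ⟨i, ?_⟩
  have h := hp i (Set.mem_univ i)
  have hδpos := gridStep_pos L
  rcases lt_or_ge (cellCorner j i) 0 with hc | hc
  · rw [abs_of_neg hc] at hi
    have hpi : p i < 0 := by linarith [h.2]
    rw [abs_of_neg hpi]
    linarith [h.2]
  · rw [abs_of_nonneg hc] at hi
    have hpi : 0 < p i := by linarith [h.1]
    rw [abs_of_pos hpi]
    linarith [h.1]

/-- **A far cell**: if `h_z` varies by at most `ε'` on the cell, its integral over the cell is
within `δ^d ε'` of `δ^d h_z(c_j)`. [folklore] -/
theorem abs_sub_setIntegral_gridCell_le {L : ℕ} [NeZero L] (z : Site d) (j : TorusSite d L)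
    {ε' : ℝ} (hint : IntegrableOn (greenIntegrand z) (gridCell j))
    (hcell : ∀ p ∈ gridCell j,
      |greenIntegrand z p - greenIntegrand z (cellCorner j)| ≤ ε') :
    |gridStep L ^ d * greenIntegrand z (cellCorner j) -
        ∫ p in gridCell j, greenIntegrand z p| ≤ gridStep L ^ d * ε' := by
  have hvol : volume.real (gridCell j) = gridStep L ^ d := by
    rw [measureReal_def, volume_gridCell_toReal]
  have hlt := volume_gridCell_lt_top j
  have hconst : ∫ _ in gridCell j, greenIntegrand z (cellCorner j) =
      gridStep L ^ d * greenIntegrand z (cellCorner j) := by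
    rw [setIntegral_const, smul_eq_mul, hvol]
  have hci : IntegrableOn (fun _ => greenIntegrand z (cellCorner j)) (gridCell j) :=
    integrableOn_const hlt.ne
  rw [← hconst, ← integral_sub hci hint]
  have h := norm_setIntegral_le_of_norm_le_const hlt (f := fun p =>
    greenIntegrand z (cellCorner j) - greenIntegrand z p) (C := ε') fun p hp => by
    rw [Real.norm_eq_abs, abs_sub_comm]; exact hcell p hp
  calc |∫ p in gridCell j, greenIntegrand z (cellCorner j) - greenIntegrand z p|
      ≤ ε' * gridStep L ^ d := by simpa [Real.norm_eq_abs, hvol] using h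
    _ = gridStep L ^ d * ε' := mul_comm _ _


/-! ### Assembly: `G_L → G` along even `L` -/

/-- A corner belongs to its (half-open) cell. [folklore] -/
theorem cellCorner_mem_gridCell {L : ℕ} [NeZero L] (j : TorusSite d L) :
    cellCorner j ∈ gridCell j := fun i _ =>
  ⟨le_rfl, by linarith [gridStep_pos L]⟩

variable (d) in
/-- `|(ℤ/Lℤ)^d| = L^d`. [folklore] -/
theorem card_torusSite (L : ℕ) [NeZero L] : Fintype.card (TorusSite d L) = L ^ d := by
  simp [Fintype.card_pi, ZMod.card]

variable (d) in
/-- **ADS15 §3.3, arXiv v3 eq. (3.15), for the nearest-neighbour model in `d ≥ 3`, proved**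
(Aizenman–Duminil-Copin–Sidoravicius, CMP 334 (2015), §3.3: "the sum (3.14) forms a Riemann
approximation; under Condition (1.18) standard approximation arguments allow to conclude the
pointwise convergence `lim_L G_L(x,y) = G(x,y)`"): for `d ≥ 3`, `z ∈ ℤ^d` and `ε > 0` there is
`L₀` such that `|torusGreen (z mod L) - latticeGreen z| ≤ ε` for all even `L ≥ L₀`. Proof: tile
`[-π,π)^d` into the `L^d` cells `c_j + [0, 2π/L)^d`; away from an `η`-neighbourhood of the origin
`h_z = cos(p·z)/ε(p)` is uniformly continuous, so cell integrals and `δ^d h_z(c_j)` differ by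
`o(1)` in total; near the origin the grid sum is `O(η^{d-2})` uniformly in `L` (lattice sum bound)
and the integral is small by absolute continuity (`1/ε ∈ L¹`, `d ≥ 3`). [cite: AizenmanDuminilCopinSidoraviciusCMP2015, §3.3, arXiv v3 eq. (3.15)] -/
theorem torusGreen_tendsto_latticeGreen (hd : 3 ≤ d) (z : Site d) {ε : ℝ} (hε : 0 < ε) :
    ∃ L₀ : ℕ, ∀ (L : ℕ) [NeZero L], Even L → L₀ ≤ L →
      |torusGreen (Torus.proj L z) - latticeGreen z| ≤ ε := by
  have hd0 : (0 : ℝ) < d := by exact_mod_cast (by omega : 0 < d)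
  set Cπ : ℝ := (2 * π) ^ d with hCπ
  have hCπ_pos : 0 < Cπ := by positivity
  set C₁ : ℝ := π ^ 2 * d * 3 ^ (d - 1) with hC₁
  have hC₁_pos : 0 < C₁ := by positivity
  set f := (brillouin d).indicator (fun p : Fin d → ℝ => 1 / dispersion p) with hf
  -- (1) the near integrals
  obtain ⟨t, ht, hnearI⟩ := exists_setIntegral_punctBall_le d hd (ε := ε * Cπ / 3) (by positivity)
  -- (2) the size `η` of the neighbourhood of the singularity
  set η : ℝ := min 1 (min (t / 2) (ε * Cπ / (3 * C₁))) with hη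
  have hη_pos : 0 < η := lt_min one_pos (lt_min (by positivity) (by positivity))
  have hη1 : η ≤ 1 := min_le_left _ _
  have hηt : 2 * η ≤ t := by
    have : η ≤ t / 2 := (min_le_right _ _).trans (min_le_left _ _)
    linarith
  have hηC : C₁ * η ≤ ε * Cπ / 3 := by
    have h : η ≤ ε * Cπ / (3 * C₁) := (min_le_right _ _).trans (min_le_right _ _)
    rw [le_div_iff₀ (by positivity)] at h
    linarith
  -- (3) uniform continuity of `h_z` away from the singularity
  have huc := (isCompact_farRegion d (η / 2)).uniformContinuousOn_of_continuous
    (continuousOn_greenIntegrand z (by positivity : 0 < η / 2))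
  obtain ⟨η', hη', hUC⟩ := Metric.uniformContinuousOn_iff_le.1 huc (ε / 3) (by positivity)
  -- (4) the threshold `L₀`: grid step below `min (η/2) η'`
  set m : ℝ := min (η / 2) η' with hm
  have hm_pos : 0 < m := lt_min (by positivity) hη'
  obtain ⟨L₀, hL₀⟩ := exists_nat_gt (2 * π / m)
  refine ⟨L₀, fun L _ hLe hL₀L => ?_⟩
  have hL : 2 * π / m < L := lt_of_lt_of_le hL₀ (by exact_mod_cast hL₀L)
  have hLpos : (0 : ℝ) < L := lt_trans (by positivity) hL
  have hδ : gridStep L ≤ m := by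
    unfold gridStep
    rw [div_le_iff₀ hLpos]
    rw [div_lt_iff₀ hm_pos] at hL
    linarith
  have hδη2 : gridStep L ≤ η / 2 := hδ.trans (min_le_left _ _)
  have hδη' : gridStep L ≤ η' := hδ.trans (min_le_right _ _)
  have hδη : gridStep L ≤ η := by linarith
  have hδpos := gridStep_pos L
  -- rewrite both Green functions as sums over the cells
  have hI := integrableOn_greenIntegrand d hd z
  rw [torusGreen_proj_eq, sum_greenIntegrand_latticeMomentum_eq hLe z, latticeGreen_eq,
    setIntegral_brillouin_eq_sum_gridCell L hI]
  set j₀ := centerIndex d L with hj₀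
  set A : TorusSite d L → ℝ := fun j => gridStep L ^ d * greenIntegrand z (cellCorner j)
    with hA
  set I : TorusSite d L → ℝ := fun j => ∫ p in gridCell j, greenIntegrand z p with hI'
  set N := nearCells d L η with hN
  -- `L^d = (2π)^d / δ^d`
  have hLd : ((L : ℝ) ^ d) = Cπ / gridStep L ^ d := by
    rw [eq_div_iff (by positivity), hCπ, ← mul_pow, mul_comm, gridStep_mul]
  have hT : (∑ j ∈ univ.erase j₀, greenIntegrand z (cellCorner j)) / (L : ℝ) ^ d =
      (∑ j ∈ univ.erase j₀, A j) / Cπ := by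
    rw [hLd, hA]
    simp only [← Finset.mul_sum]
    field_simp
  rw [hT, show (∑ j, ∫ p in gridCell j, greenIntegrand z p) = ∑ j, I j from rfl, ← sub_div,
    abs_div, abs_of_pos hCπ_pos, div_le_iff₀ hCπ_pos]
  -- split the index set into near and far cells
  have hj₀N : j₀ ∈ N := by
    refine Finset.mem_filter.2 ⟨mem_univ _, fun i => ?_⟩
    rw [hj₀, cellCorner_centerIndex d hLe]
    simp [hη_pos.le]
  have hsdiff : univ.erase j₀ \ N.erase j₀ = univ \ N := by
    ext j
    simp only [Finset.mem_sdiff, Finset.mem_erase, mem_univ, and_true, true_and, not_and]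
    constructor
    · rintro ⟨hj, h⟩; exact h hj
    · intro h; exact ⟨fun hjj => h (hjj ▸ hj₀N), fun _ => h⟩
  have hsplitA : ∑ j ∈ univ.erase j₀, A j = ∑ j ∈ univ \ N, A j + ∑ j ∈ N.erase j₀, A j := by
    rw [← Finset.sum_sdiff (Finset.erase_subset_erase j₀ (subset_univ N)), hsdiff]
  have hsplitI : ∑ j, I j = ∑ j ∈ univ \ N, I j + ∑ j ∈ N, I j := by
    rw [← Finset.sum_sdiff (subset_univ N)]
  -- (a) far cells
  have hfar : ∀ j ∈ univ \ N, |A j - I j| ≤ gridStep L ^ d * (ε / 3) := by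
    intro j hj
    have hjN : j ∉ N := (Finset.mem_sdiff.1 hj).2
    have hsub := gridCell_subset_farRegion hδη2 hjN
    refine abs_sub_setIntegral_gridCell_le z j (hI.mono_set (gridCell_subset_brillouin j))
      fun p hp => ?_
    have h := hUC p (hsub hp) (cellCorner j) (hsub (cellCorner_mem_gridCell j)) ?_
    · rwa [Real.dist_eq] at h
    · refine (dist_pi_le_iff hδpos.le).2 (fun i => ?_) |>.trans hδη'
      have hpi := hp i (Set.mem_univ i)
      rw [Real.dist_eq, abs_le]
      constructor <;> linarith [hpi.1, hpi.2]
  have hcard : (#(univ \ N) : ℝ) * gridStep L ^ d ≤ Cπ := by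
    have h1 : (#(univ \ N) : ℝ) ≤ (L : ℝ) ^ d := by
      have := Finset.card_le_univ (univ \ N)
      rw [card_torusSite] at this
      exact_mod_cast this
    calc (#(univ \ N) : ℝ) * gridStep L ^ d ≤ (L : ℝ) ^ d * gridStep L ^ d := by gcongr
      _ = Cπ := by rw [← mul_pow, mul_comm, gridStep_mul]
  have ha : |∑ j ∈ univ \ N, (A j - I j)| ≤ ε * Cπ / 3 := by
    calc |∑ j ∈ univ \ N, (A j - I j)| ≤ ∑ j ∈ univ \ N, |A j - I j| := abs_sum_le_sum_abs _ _
      _ ≤ ∑ j ∈ univ \ N, gridStep L ^ d * (ε / 3) := Finset.sum_le_sum hfar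
      _ = #(univ \ N) * gridStep L ^ d * (ε / 3) := by rw [sum_const, nsmul_eq_mul, mul_assoc]
      _ ≤ Cπ * (ε / 3) := by gcongr
      _ = ε * Cπ / 3 := by ring
  -- (b) near cells, grid part
  have hb : |∑ j ∈ N.erase j₀, A j| ≤ ε * Cπ / 3 := by
    have h1 := sum_nearCells_abs_greenIntegrand_le d hd hLe z hη_pos
    have h2 : η ^ (d - 2) ≤ η := pow_le_of_le_one hη_pos.le hη1 (by omega)
    calc |∑ j ∈ N.erase j₀, A j| ≤ ∑ j ∈ N.erase j₀, |A j| := abs_sum_le_sum_abs _ _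
      _ = ∑ j ∈ N.erase j₀, gridStep L ^ d * |greenIntegrand z (cellCorner j)| := by
          refine Finset.sum_congr rfl fun j _ => ?_
          rw [hA]; simp only [abs_mul, abs_of_pos (pow_pos hδpos d)]
      _ ≤ C₁ * η ^ (d - 2) := h1
      _ ≤ C₁ * η := by gcongr
      _ ≤ ε * Cπ / 3 := hηC
  -- (c) near cells, integral part
  have hc : |∑ j ∈ N, I j| ≤ ε * Cπ / 3 := by
    calc |∑ j ∈ N, I j| ≤ ∑ j ∈ N, |I j| := abs_sum_le_sum_abs _ _
      _ ≤ ∑ j ∈ N, ∫ p in gridCell j, |greenIntegrand z p| :=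
          Finset.sum_le_sum fun j _ => abs_integral_le_integral_abs
      _ ≤ ∫ p in punctBall d (2 * η), f p := sum_nearCells_integral_abs_le d hd z hδη
      _ ≤ ε * Cπ / 3 := hnearI (2 * η) (by positivity) hηt
  -- combine
  rw [hsplitA, hsplitI]
  have hre : ∑ j ∈ univ \ N, A j + ∑ j ∈ N.erase j₀, A j - (∑ j ∈ univ \ N, I j + ∑ j ∈ N, I j) =
      ∑ j ∈ univ \ N, (A j - I j) + ∑ j ∈ N.erase j₀, A j - ∑ j ∈ N, I j := by
    rw [Finset.sum_sub_distrib]; ring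
  rw [hre]
  calc |∑ j ∈ univ \ N, (A j - I j) + ∑ j ∈ N.erase j₀, A j - ∑ j ∈ N, I j|
      ≤ |∑ j ∈ univ \ N, (A j - I j)| + |∑ j ∈ N.erase j₀, A j| + |∑ j ∈ N, I j| := by
        refine (abs_sub _ _).trans ?_
        gcongr
        exact abs_add_le _ _
    _ ≤ ε * Cπ / 3 + ε * Cπ / 3 + ε * Cπ / 3 := by gcongr
    _ = ε * Cπ := by ring

end Literature.Probability.LatticeModels
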